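import Summits.CriticalPhenomena.CardyFormulaZ2.Theses.CardyDualCurrent
import Literature.Probability.LatticeModels.LocalParafermionicTemplate

/-!
# `CanonicalLimitFromExactCR` (stmt-CriticalPhenomena-11394): the logical reduction, in Lean

Route `CardyDualCurrent`, sub-problem `CriticalPhenomena/CardyFormulaZ2`. The crux
`CanonicalLimitFromExactCR` (rank 4) is, by `Iff.rfl`, the implication
"body of `DualCurrentTemplateR` (r2, stmt-11201) → body of `TemplateCanonicalLimit` (r9,
stmt-11393)": the consequent re-chooses its own template, nothing of the antecedent's witness
is threaded. This file records the resulting dichotomy kernel-checked, so that the item closes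
MECHANICALLY from whichever of the two open decisions lands first:

* `canonicalLimitFromExactCR_iff_imp` — crux `↔ (DualCurrentTemplateR → TemplateCanonicalLimit)`;
* `canonicalLimitFromExactCR_of_not_dualCurrentTemplateR` — a refutation of r2 closes the crux;
* `canonicalLimitFromExactCR_of_templateCanonicalLimit` — a proof of r9 closes the crux;
* `canonicalLimitFromExactCR_iff_not_or` — crux `↔ (¬ DualCurrentTemplateR ∨ TemplateCanonicalLimit)`;
* `canonicalLimitFromExactCR_iff_template` — the structured reading: crux
  `↔ ((∃ T : LocalParafermionicTemplate, T.IsExactCR ∧ T.Nondegenerate) → TemplateCanonicalLimit)`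
  (`LocalParafermionicTemplate.exists_isExactCR_and_nondegenerate_iff`);
* `canonicalLimitFromExactCR_of_forall_not` — in particular an all-ranges negative result
  `∀ T, T.IsExactCR → ¬ T.Nondegenerate` (every exactly discrete-holomorphic finite-range local
  parafermionic template of bond percolation on `ℤ²` is degenerate) closes the crux.

All proofs are definitional unfoldings / propositional logic; no analysis is involved (the
refuter crux-attack of 2026-08-15 reported the first four as evidence; they are landed here).
-/

namespace Summit.CriticalPhenomena.CardyFormulaZ2.Theorems

open Summit.CriticalPhenomena.CardyFormulaZ2.Theses.CardyDualCurrent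
open Literature.Probability.LatticeModels

/-- The crux `CanonicalLimitFromExactCR` is literally the implication r2 → r9. [folklore] -/
theorem canonicalLimitFromExactCR_iff_imp :
    CanonicalLimitFromExactCR ↔ (DualCurrentTemplateR → TemplateCanonicalLimit) :=
  Iff.rfl

/-- A refutation of the decision crux `DualCurrentTemplateR` (stmt-11201) closes the crux
`CanonicalLimitFromExactCR` vacuously. [folklore] -/
theorem canonicalLimitFromExactCR_of_not_dualCurrentTemplateR (h : ¬ DualCurrentTemplateR) :
    CanonicalLimitFromExactCR :=
  fun h2 => (h h2).elim

/-- A proof of the support item `TemplateCanonicalLimit` (stmt-11393) closes the crux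
`CanonicalLimitFromExactCR` outright. [folklore] -/
theorem canonicalLimitFromExactCR_of_templateCanonicalLimit (h : TemplateCanonicalLimit) :
    CanonicalLimitFromExactCR :=
  fun _ => h

/-- The crux is EQUIVALENT to the disjunction "r2 is false or r9 is true". [folklore] -/
theorem canonicalLimitFromExactCR_iff_not_or : Summit.CriticalPhenomena.CardyFormulaZ2.Theses.CardyDualCurrent.CanonicalLimitFromExactCR ↔ (¬ Summit.CriticalPhenomena.CardyFormulaZ2.Theses.CardyDualCurrent.DualCurrentTemplateR ∨ Summit.CriticalPhenomena.CardyFormulaZ2.Theses.CardyDualCurrent.TemplateCanonicalLimit) := by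
  rw [canonicalLimitFromExactCR_iff_imp]
  exact imp_iff_not_or

/-- Structured reading of the crux over `LocalParafermionicTemplate`: it says that the existence
of an exactly discrete-holomorphic, deep-window non-degenerate finite-range template implies
`TemplateCanonicalLimit`. [folklore] -/
theorem canonicalLimitFromExactCR_iff_template :
    CanonicalLimitFromExactCR ↔
      ((∃ T : LocalParafermionicTemplate, T.IsExactCR ∧ T.Nondegenerate) →
        TemplateCanonicalLimit) := by
  rw [canonicalLimitFromExactCR_iff_imp,
    LocalParafermionicTemplate.exists_isExactCR_and_nondegenerate_iff]
  rfl

/-- An all-ranges negative theorem — every exactly discrete-holomorphic finite-range local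
parafermionic template of `p = 1/2` bond percolation on `ℤ²` is degenerate — closes the crux.
[folklore] -/
theorem canonicalLimitFromExactCR_of_forall_not
    (h : ∀ T : LocalParafermionicTemplate, T.IsExactCR → ¬ T.Nondegenerate) :
    CanonicalLimitFromExactCR :=
  canonicalLimitFromExactCR_iff_template.2 fun ⟨T, hCR, hND⟩ => (h T hCR hND).elim

end Summit.CriticalPhenomena.CardyFormulaZ2.Theorems
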